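import Summits.CriticalPhenomena.SAWScalingLimit.Theorems.SAWDefectDecoherenceObservableToSLERNestedLinkDefs
import Summits.CriticalPhenomena.SAWScalingLimit.Theorems.SAWDefectDecoherenceObservableToSLERCarvedDictionary
import Summits.CriticalPhenomena.SAWScalingLimit.Theorems.SAWDefectDecoherenceObservableToSLERCarvedDictionaryHalfBall
import HarnessLib

/-!
# Class-zero window dictionary (line `bridge-gate-renewal`, reshape r6, stub 5a
`stub_carvedSeqIdentificationCZ`; crux `SAWDefectDecoherence.ObservableToSLER`,
stmt-CriticalPhenomena-14005)

Landing target: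
`Summits/CriticalPhenomena/SAWScalingLimit/Theorems/SAWDefectDecoherenceObservableToSLERClassZeroAudit.lean`
(`--supports stmt-CriticalPhenomena-14005`).  Audit-by-Lean helper of the worker audit of stub 5a
(r6): the LITERAL bridge from the r6 family constraint `ClassZeroWindows` (skeleton
`Cruxes/ObservableToSLER/Lines/bridge_gate_renewal.lean`, inlined here as the hypothesis `hCZ`,
never named) to the two-ball clauses of the route hypothesis `HexObservableLimitR` (item 14003)
at a re-rooted gate of a carved lattice domain `Ω_δ ∖ (S n ∪ T n')`:

* `classZero_window_dictionary` — a clean window of a class-zero family is, in the `ρ`-ball about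
  the new root `q`, EXACTLY the complement of the upper half-lattice `{rowOf 0 · ≥ rowOf 0 p + 1}`
  (`rowOf 0 v = v.1 1`, `rowOf_zero`: the row function of `HexObservableLimitR`'s lattice clause
  `v ∈ Λ δ ↔ m i δ ≤ v.1 1`, with `m i δ := rowOf 0 p + 1`), and the closed `ρ`-ball lies in `Ω`;
* `classZero_gate_eq` — at a class-zero gate EDGE `{p, q}` the new root is the up-face `q = (x, 0)`
  and `p = (x - e₁, 1)` is the down-face straight below it (vertical gate edge, horizontal gate
  line `Im = x₁ √3/2 · δ`): the marked boundary mid-edge `s(q, p)` of the carved domain is a FLOOR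
  mid-edge in the sense of crux 10472's `IsFloorEndpointApprox` (`im c_p < im c_q`,
  `classZero_gate_im_lt`);
* `classZero_carved_halfLattice` — THE LATTICE CLAUSE OF `R` FOR THE CARVED VERTEX SET, with no
  residual hypothesis beyond "the other level `T n'` does not meet the window ball" and "the new
  root is a vertex of `Ω_δ`": inside the window ball,
  `x ∈ carvedVerts (Ω_δ) (S n ∪ T n') q ↔ rowOf 0 p + 1 ≤ rowOf 0 x`
  (`mem_carvedVerts_iff_of_window` of `…CarvedDictionary.lean` + the row-zero half-ball
  connectivity `exists_walk_halfBall_rowZero` of `…CarvedDictionaryHalfBall.lean`, which in r6 is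
  the ONLY orientation);
* `HasCleanWindow.radius_lt_dist` and `not_mem_ball_of_local` — the two metric facts behind the
  "no intrusion of `T n'` into the window at `q`" clause: a clean window forces
  `ρ < dist (δ c_q, z)` for every `z ∉ Ω` (so `ρ < R + δ/√3 + dist (δ c_a, pt 0)` along the line's
  data), and a level inside the closed `R`-ball about its root misses every `ρ`-ball whose centre
  is more than `R + ρ` away from that root; hence for `R ≤ dist (pt 0, pt 1)/4` and small meshes no
  vertex of `T n'` lies in the window ball at `q` (and symmetrically).

Sources: H. Duminil-Copin, S. Smirnov, Ann. of Math. 175 (2012) (arXiv:1007.0575) §3 (the flat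
bottom boundary `α` and its vertical mid-edges), §4 (the discrete domains); the line's dictionary
files `…CarvedDictionary.lean` (p-landed, audit (i)–(iv)) and `…CarvedDictionaryHalfBall.lean`.
No statement of the line is asserted or named here.
-/

noncomputable section

open scoped BigOperators Topology NNReal ENNReal Classical
open Filter Set MeasureTheory Metric
open Literature.Probability.LatticeModels (HexVertex hexGraph hexCenter Site
  hexGraph_adj_iff_of_snd_eq_zero_holds hexGraph_adj_iff_of_snd_eq_one)
open Literature.Probability.Percolation (hexCenter_re hexCenter_im)
open Literature.Probability.RandomPlanarGeometry
open Literature.Probability.RandomPlanarGeometry.SAW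

namespace Summit.CriticalPhenomena.SAWScalingLimit.Theorems.ObservableToSLER.BridgeGate

open Summit.CriticalPhenomena.SAWScalingLimit.Theorems.ObservableToSLER.NestedGate
  (TameNestedFamily)

/-! ### The window dictionary -/

/-- **CLASS-ZERO WINDOW DICTIONARY.**  If every clean `ρ`-window of the family `S` is of class `0`
(the r6 constraint `ClassZeroWindows Ω δ ρ S`, inlined as `hCZ`), then at a clean window `(p, q)`
of the level `S n`: the closed `ρ`-ball about the rescaled new root lies in `Ω`, the new root is
one row above the gate vertex, and inside the ball the COMPLEMENT of the level is exactly the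
upper half-lattice `{x | rowOf 0 p + 1 ≤ rowOf 0 x}` — the lattice clause of `HexObservableLimitR`
with threshold `m := rowOf 0 p + 1` (`rowOf 0 x = x.1 1`). [folklore] -/
theorem classZero_window_dictionary :
    ∀ (Ω : Set ℂ) (δ ρ : ℝ) (S : ℕ → Set HexVertex) (n : ℕ) (p q : HexVertex),
      (∀ (n : ℕ) (p q : HexVertex), HasCleanWindow Ω δ ρ (S n) p q →
        rowOf 0 q = rowOf 0 p + 1 ∧
          ∀ x : HexVertex, (δ : ℂ) * hexCenter x ∈ ball ((δ : ℂ) * hexCenter q) ρ →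
            (x ∈ S n ↔ rowOf 0 x ≤ rowOf 0 p)) →
      HasCleanWindow Ω δ ρ (S n) p q →
      closedBall ((δ : ℂ) * hexCenter q) ρ ⊆ Ω ∧ rowOf 0 q = rowOf 0 p + 1 ∧
        ∀ x : HexVertex, (δ : ℂ) * hexCenter x ∈ ball ((δ : ℂ) * hexCenter q) ρ →
          (x ∉ S n ↔ rowOf 0 p + 1 ≤ rowOf 0 x) := by
  intro Ω δ ρ S n p q hCZ hW
  obtain ⟨hrow, hwin⟩ := hCZ n p q hW
  refine ⟨hW.1, hrow, fun x hx => ?_⟩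
  rw [hwin x hx]
  omega

/-- The window radius is smaller than the distance from the new root to any point outside the
domain (the closed window ball lies in `Ω`).  With `z := D.pt 0 ∉ D.carrier` and
`dist (δ c_q, δ c_a) ≤ R + δ/√3` this is the bound `ρ < R + δ/√3 + dist (δ c_a, pt 0)` used by
the audit to exclude intrusion of the other level into the window. [folklore] -/
theorem HasCleanWindow.radius_lt_dist {Ω : Set ℂ} {δ ρ : ℝ} {S : Set HexVertex} {p q : HexVertex}
    (h : HasCleanWindow Ω δ ρ S p q) {z : ℂ} (hz : z ∉ Ω) :
    ρ < dist ((δ : ℂ) * hexCenter q) z := by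
  by_contra hle
  push Not at hle
  exact hz (h.1 (mem_closedBall'.2 hle))

/-- **No intrusion from a far root.**  A set all of whose rescaled vertices lie within `R` of the
rescaled root `c` (the locality clause of `TameNestedFamily`) misses the open `ρ`-ball about any
point at distance `≥ R + ρ` from the rescaled root. [folklore] -/
theorem not_mem_ball_of_local {δ R ρ : ℝ} {U : Set HexVertex} {c : HexVertex} {w : ℂ}
    (hU : ∀ v ∈ U, dist ((δ : ℂ) * hexCenter v) ((δ : ℂ) * hexCenter c) ≤ R)
    (hfar : R + ρ ≤ dist w ((δ : ℂ) * hexCenter c)) :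
    ∀ x : HexVertex, (δ : ℂ) * hexCenter x ∈ ball w ρ → x ∉ U := by
  intro x hx hxU
  have h1 := hU x hxU
  rw [mem_ball] at hx
  have h2 := dist_triangle w ((δ : ℂ) * hexCenter x) ((δ : ℂ) * hexCenter c)
  rw [dist_comm w ((δ : ℂ) * hexCenter x)] at h2
  linarith

/-- The locality clause of a tame nested family, extracted: every level lies in the closed
`R`-ball about the rescaled root. [folklore] -/
theorem tame_local {δ R : ℝ} {N : ℕ} {c : HexVertex} {S : ℕ → Set HexVertex}
    (h : TameNestedFamily δ R N c S) (n : ℕ) :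
    ∀ v ∈ S n, dist ((δ : ℂ) * hexCenter v) ((δ : ℂ) * hexCenter c) ≤ R :=
  h.2.2.1 n

/-- **No intrusion of the far family into the window**, assembled: if the level `T n'` is local
at scale `R` about its root `c'` and the window centre is at distance `≥ R + ρ` from the rescaled
`c'`, no vertex of `T n'` has its rescaled centre in the window ball.  (Along the line's data the
distance hypothesis holds for all small meshes as soon as `4R < dist (pt 0, pt 1)`, by
`HasCleanWindow.radius_lt_dist` and the endpoint approximation.) [folklore] -/
theorem window_disjoint_far_level {δ R ρ : ℝ} {N : ℕ} {c' q : HexVertex}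
    {T : ℕ → Set HexVertex} (hT : TameNestedFamily δ R N c' T) (n' : ℕ)
    (hfar : R + ρ ≤ dist ((δ : ℂ) * hexCenter q) ((δ : ℂ) * hexCenter c')) :
    ∀ x : HexVertex, (δ : ℂ) * hexCenter x ∈ ball ((δ : ℂ) * hexCenter q) ρ → x ∉ T n' :=
  not_mem_ball_of_local (tame_local hT n') hfar

/-! ### Class-zero gates are vertical edges below an up-face -/

/-- **At a class-zero gate edge the new root is an up-face and the gate vertex is the down-face
straight below it**: if `q ∼ p` and `rowOf 0 q = rowOf 0 p + 1` then `q = (x, 0)` and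
`p = (x - e₁, 1)` for `x = q.1` (`gate_rowZero_eq`, `gate_rowZero_ne_down` of the half-ball
file, packaged over a general `q`). [folklore] -/
theorem classZero_gate_eq {p q : HexVertex} (hadj : hexGraph.Adj q p)
    (hrow : rowOf 0 q = rowOf 0 p + 1) :
    q = (q.1, 0) ∧ p = (q.1 - Pi.single 1 1, 1) := by
  obtain ⟨x, t⟩ := q
  rw [rowOf_zero, rowOf_zero] at hrow
  fin_cases t
  · exact ⟨rfl, gate_rowZero_eq x hadj hrow⟩
  · exact (gate_rowZero_ne_down x hadj hrow).elim

/-- **The gate vertex lies strictly below the new root** (the gate edge is vertical, of length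
`1/√3`, the gate line horizontal): `im c_p < im c_q` at a class-zero gate edge.  Rescaled by a
positive mesh this is the floor-vertex clause of crux 10472's `IsFloorEndpointApprox` for the
carved domain marked at the gate point. [folklore] -/
theorem classZero_gate_im_lt {p q : HexVertex} (hadj : hexGraph.Adj q p)
    (hrow : rowOf 0 q = rowOf 0 p + 1) :
    (hexCenter p).im < (hexCenter q).im ∧ (hexCenter p).re = (hexCenter q).re := by
  obtain ⟨hq, hp⟩ := classZero_gate_eq hadj hrow
  have s1 : (q.1 - Pi.single 1 1 : Site 2) 0 = q.1 0 ∧ (q.1 - Pi.single 1 1 : Site 2) 1 = q.1 1 - 1 := by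
    simp
  rw [hq, hp, hexCenter_im, hexCenter_im, hexCenter_re, hexCenter_re, s1.1, s1.2]
  simp only [Fin.val_one, Nat.cast_one, Fin.val_zero, Nat.cast_zero, Int.cast_sub, Int.cast_one]
  constructor
  · have h3 : 0 < Real.sqrt 3 / 2 := by positivity
    nlinarith
  · ring

/-! ### The lattice clause of `R` for the carved vertex set -/

/-- **THE EXACT HALF-LATTICE CLAUSE OF `HexObservableLimitR` FOR THE CARVED VERTEX SET AT A
CLASS-ZERO WINDOW.**  Let every clean window of `S` be of class `0` (`hCZ`), let `(p, q)` be a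
clean window of `S n` at a gate EDGE `q ∼ p`, let the other removed set `T'` (in the line `T n'`)
miss the window ball, and let the new root `q` be a vertex of `Ω_δ`.  Then inside the window ball
membership in the carved vertex set `carvedVerts (Ω_δ) (S n ∪ T') q` (the lattice domain carrying
`carvedLaw Ω δ (S n ∪ T') q ·`) is EXACTLY `rowOf 0 p + 1 ≤ rowOf 0 x` — the clause
`v ∈ Λ δ ↔ m i δ ≤ v.1 1` of `HexObservableLimitR` with `m i δ := rowOf 0 p + 1`, on the full
ball of radius `ρ` about `δ c_q`. [folklore] -/
theorem classZero_carved_halfLattice {Ω : Set ℂ} {δ ρ : ℝ} {S : ℕ → Set HexVertex}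
    {T' : Set HexVertex} {n : ℕ} {p q : HexVertex}
    (hCZ : ∀ (n : ℕ) (p q : HexVertex), HasCleanWindow Ω δ ρ (S n) p q →
      rowOf 0 q = rowOf 0 p + 1 ∧
        ∀ x : HexVertex, (δ : ℂ) * hexCenter x ∈ ball ((δ : ℂ) * hexCenter q) ρ →
          (x ∈ S n ↔ rowOf 0 x ≤ rowOf 0 p))
    (hW : HasCleanWindow Ω δ ρ (S n) p q) (hadj : hexGraph.Adj q p)
    (hT : ∀ x : HexVertex, (δ : ℂ) * hexCenter x ∈ ball ((δ : ℂ) * hexCenter q) ρ → x ∉ T')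
    (hq : q ∈ embMeshDomain hexGraph hexCenter Ω δ) :
    ∀ x : HexVertex, (δ : ℂ) * hexCenter x ∈ ball ((δ : ℂ) * hexCenter q) ρ →
      (x ∈ carvedVerts (hexDomainGraph Ω δ) (S n ∪ T') q ↔ rowOf 0 p + 1 ≤ rowOf 0 x) := by
  obtain ⟨hball, hrow, hwin⟩ := classZero_window_dictionary Ω δ ρ S n p q hCZ hW
  obtain ⟨hqeq, -⟩ := classZero_gate_eq hadj hrow
  have hΩ : ball ((δ : ℂ) * hexCenter q) ρ ⊆ Ω := ball_subset_closedBall.trans hball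
  have hwinS : ∀ x : HexVertex, (δ : ℂ) * hexCenter x ∈ ball ((δ : ℂ) * hexCenter q) ρ →
      (x ∈ S n ↔ rowOf 0 x ≤ rowOf 0 p) := (hCZ n p q hW).2
  intro x hx
  refine mem_carvedVerts_iff_of_window (W := ball ((δ : ℂ) * hexCenter q) ρ) hΩ Subset.rfl
    hwinS hT hq ?_ hx
  -- half-ball connectivity above the gate row, orientation `0` (the only one in r6)
  intro v hv hvrow
  have hq1 : rowOf 0 p + 1 = q.1 1 := by rw [← hrow, rowOf_zero]
  have hvrow' : q.1 1 ≤ v.1 1 := by rw [← hq1, ← rowOf_zero]; exact hvrow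
  rw [hqeq] at hv ⊢
  obtain ⟨w, hw⟩ := exists_walk_halfBall_rowZero (δ := δ) (ρ := ρ) q.1 hv hvrow'
  refine ⟨w, fun y hy => ⟨(hw y hy).1, ?_⟩⟩
  show rowOf 0 p + 1 ≤ rowOf 0 y
  rw [hq1, rowOf_zero]
  exact (hw y hy).2

/-- **Registered sub-goal form** (crux item stmt-CriticalPhenomena-14005, line
`bridge-gate-renewal` r6, stub `stub_carvedSeqIdentificationCZ`, audit point (A)): at a
class-zero clean window of a gate edge not met by the other removed set, the `S ∪ T'`-avoiding
walks of `Ω_δ` from the new root reach a vertex of the window ball iff it lies on or above the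
row of the new root (`classZero_carved_halfLattice` with `carvedVerts` unfolded). [folklore] -/
theorem stub_csiCZ_windowClause :
    ∀ (Ω : Set ℂ) (δ ρ : ℝ) (S : ℕ → Set HexVertex) (T' : Set HexVertex) (n : ℕ)
      (p q : HexVertex),
      (∀ (n : ℕ) (p q : HexVertex), HasCleanWindow Ω δ ρ (S n) p q →
        rowOf 0 q = rowOf 0 p + 1 ∧
          ∀ x : HexVertex, (δ : ℂ) * hexCenter x ∈ Metric.ball ((δ : ℂ) * hexCenter q) ρ →
            (x ∈ S n ↔ rowOf 0 x ≤ rowOf 0 p)) →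
      HasCleanWindow Ω δ ρ (S n) p q → hexGraph.Adj q p →
      (∀ x : HexVertex, (δ : ℂ) * hexCenter x ∈ Metric.ball ((δ : ℂ) * hexCenter q) ρ → x ∉ T') →
      q ∈ embMeshDomain hexGraph hexCenter Ω δ →
      ∀ x : HexVertex, (δ : ℂ) * hexCenter x ∈ Metric.ball ((δ : ℂ) * hexCenter q) ρ →
        ((∃ π : (hexDomainGraph Ω δ).Walk q x, ∀ y ∈ π.support, y ∉ S n ∪ T') ↔
          rowOf 0 p + 1 ≤ rowOf 0 x) :=
  fun _ _ _ _ _ _ _ _ hCZ hW hadj hT hq x hx => classZero_carved_halfLattice hCZ hW hadj hT hq x hx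

end Summit.CriticalPhenomena.SAWScalingLimit.Theorems.ObservableToSLER.BridgeGate

end
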